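import Mathlib.Combinatorics.SetFamily.FourFunctions
import Mathlib.Tactic
import HarnessLib
import Literature.Combinatorics.SetFamily.AhlswedeDaykinDifferences
import Summits.CriticalPhenomena.PercolationContinuityZ3.Theorems.PercNearOneGluingNoHeavyLowerTailSahiColouredDaykin
import Summits.CriticalPhenomena.PercolationContinuityZ3.Theorems.PercNearOneGluingNoHeavyLowerTailSahiColouredDaykinTwoColours

/-!
# Signed coloured Daykin (`SignedColouredDaykin3`): the dominated configurations, via Ahlswede–Daykin

Support file (seat `prim-masterthm-p1`, gen 28; `--supports stmt-CriticalPhenomena-4575`).  No new definitions, no `sorry`,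
standard axioms.

The typed conjecture `SignedColouredDaykin3` (file `…SahiColouredDaykin`, gen 27) asks, for a family `P ⊆ 2^F` without a
complementary pair and a 3-colouring `c`, that `#P ≤ #(compatJoins F P c)`.  Known before this file: one colour (Daykin /
Marica–Schönheim) and two colours (re-signing).  Here the first genuinely three-coloured class of configurations is settled:

* `card_le_card_compatJoins_of_cover_dominating` — if some colour `i` **cover-dominates**, i.e. every member `S` of another
  colour has a partner `T` of colour `i` with `S ∪ T = F`, then `#P ≤ #(compatJoins F P c)`.
* `card_le_card_compatJoins_of_disjoint_dominating` — the same when some colour `i` **disjoint-dominates**: every member of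
  another colour is disjoint from some member of colour `i`.
* `card_le_card_compatJoins_of_univ_mem`, `card_le_card_compatJoins_of_empty_mem` — in particular the conjecture holds whenever
  `F ∈ P` or `∅ ∈ P` (any colouring).

PROOF.  Ahlswede–Daykin 1979 (Ahlswede–Blinovsky, Theorem 37; tree: `Literature.Combinatorics.SetFamily.
card_le_card_diffs_of_forall_exists_subset`): if every member of `𝒮` contains a member of `𝒯` then `#𝒮 ≤ #(𝒮 \\ 𝒯)`.  Take
`𝒮 = {S ∈ P : c S ≠ i} ∪ {F \ T : T ∈ P, c T = i}` (these are `#P` distinct sets because `P` has no complementary pair) and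
`𝒯 = {F \ T : c T = i}`; cover-domination is exactly the hypothesis of Theorem 37, and every difference is the complement of a
compatible union: `S \ (F \ T) = S ∩ T = F \ ((F\S) ∪ (F\T))` (two negative members of different colours) and
`(F \ T') \ (F \ T) = T \ T' = F \ (T' ∪ (F \ T))` (positive–negative of the same colour).  The disjoint-dominated case is the
mirror image (`𝒮 = {F \ S : c S ≠ i} ∪ {T : c T = i}`, `𝒯 = {T : c T = i}`; differences `F \ (S ∪ T)` and `T' \ T`).

COVERAGE (engines `code-g28/exh37.c`, exhaustive): on `2^3` the two domination criteria cover 2292 of the 2400 signed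
3-coloured configurations and ALL 870 tight ones (`#compatJoins = #P`); on `2^4` they cover 5 263 584 of 5 764 800 (91.3 %) and
71 634 of the 73 686 tight ones.  The uncovered configurations all have slack ≥ 1 on `2^3`; the conjecture itself stays open.
HONEST FRAMING: a partial result (a class of configurations), not the conjecture. [this work]
-/

namespace Summit.CriticalPhenomena.PercolationContinuityZ3.Theorems.SahiColouredDaykin

open Finset
open scoped FinsetFamily

variable {α : Type*} [DecidableEq α]

/-- Complementation inside `F` is injective on subfamilies of `2^F`. [folklore] -/
private theorem sdiff_injOn_of_subset (F : Finset α) (𝒜 : Finset (Finset α)) (h𝒜 : ∀ S ∈ 𝒜, S ⊆ F) :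
    Set.InjOn (fun S => F \ S) ↑𝒜 := by
  intro S hS S' hS' h
  have hSF := h𝒜 S (mem_coe.1 hS)
  have hS'F := h𝒜 S' (mem_coe.1 hS')
  have : F \ (F \ S) = F \ (F \ S') := by
    show F \ ((fun S => F \ S) S) = F \ ((fun S => F \ S) S')
    rw [h]
  rwa [Finset.sdiff_sdiff_eq_self hSF, Finset.sdiff_sdiff_eq_self hS'F] at this

/-- **Cover-dominated configurations.**  If some colour `i` cover-dominates (every member of another colour has a partner of
colour `i` with which it covers `F`), then the compatible unions are at least as numerous as `P`.  Proof: Ahlswede–Daykin's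
difference inequality for `𝒮 = {S : c S ≠ i} ∪ {F \ T : c T = i}`, `𝒯 = {F \ T : c T = i}`, followed by complementation.
[this work] -/
theorem card_le_card_compatJoins_of_cover_dominating (F : Finset α) (P : Finset (Finset α)) (c : Finset α → Fin 3)
    (i : Fin 3) (hPF : ∀ S ∈ P, S ⊆ F) (hP : ∀ S ∈ P, F \ S ∉ P)
    (hdom : ∀ S ∈ P, c S ≠ i → ∃ T ∈ P, c T = i ∧ S ∪ T = F) : #P ≤ #(compatJoins F P c) := by
  classical
  set Pi := P.filter fun S => c S = i with hPi
  set Po := P.filter fun S => c S ≠ i with hPo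
  set 𝒯 : Finset (Finset α) := Pi.image fun T => F \ T with h𝒯
  set 𝒮 : Finset (Finset α) := Po ∪ 𝒯 with h𝒮
  -- counting: `#𝒮 = #P`
  have hdisj : Disjoint Po 𝒯 := by
    rw [disjoint_left]
    intro S hS hS'
    obtain ⟨T, hT, rfl⟩ := mem_image.1 hS'
    exact hP T (mem_filter.1 hT).1 (mem_filter.1 hS).1
  have hcard𝒯 : #𝒯 = #Pi :=
    card_image_of_injOn (sdiff_injOn_of_subset F Pi fun S hS => hPF S (mem_filter.1 hS).1)
  have hcard𝒮 : #𝒮 = #P := by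
    rw [h𝒮, card_union_of_disjoint hdisj, hcard𝒯, hPo, hPi, add_comm]
    exact card_filter_add_card_filter_not _
  -- hypothesis of Theorem 37
  have hhyp : ∀ S ∈ 𝒮, ∃ T ∈ 𝒯, T ⊆ S := by
    intro S hS
    rcases mem_union.1 hS with hS | hS
    · obtain ⟨hSP, hSi⟩ := mem_filter.1 hS
      obtain ⟨T, hT, hTi, hST⟩ := hdom S hSP hSi
      refine ⟨F \ T, mem_image.2 ⟨T, mem_filter.2 ⟨hT, hTi⟩, rfl⟩, ?_⟩
      intro x hx
      have hx' : x ∈ S ∪ T := by rw [hST]; exact (mem_sdiff.1 hx).1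
      exact (mem_union.1 hx').resolve_right (mem_sdiff.1 hx).2
    · exact ⟨S, hS, subset_rfl⟩
  have h37 := Literature.Combinatorics.SetFamily.card_le_card_diffs_of_forall_exists_subset 𝒮 𝒯 hhyp
  -- every difference is the complement of a compatible union
  have hmem : ∀ Z ∈ 𝒮 \\ 𝒯, Z ⊆ F ∧ F \ Z ∈ compatJoins F P c := by
    intro Z hZ
    obtain ⟨X, hX, Y, hY, rfl⟩ := mem_diffs.1 hZ
    obtain ⟨T, hT, rfl⟩ := mem_image.1 hY
    obtain ⟨hTP, hTi⟩ := mem_filter.1 hT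
    have hTF := hPF T hTP
    rcases mem_union.1 hX with hX | hX
    · obtain ⟨hSP, hSi⟩ := mem_filter.1 hX
      have hSF := hPF X hSP
      refine ⟨sdiff_subset.trans hSF, ?_⟩
      have e : F \ (X \ (F \ T)) = (F \ X) ∪ (F \ T) := by
        ext x
        have h1 : x ∈ X → x ∈ F := fun h => hSF h
        simp only [mem_sdiff, mem_union]
        tauto
      rw [e]
      exact sdiff_union_sdiff_mem_compatJoins hSP hTP (by rw [hTi]; exact hSi)
    · obtain ⟨T', hT', rfl⟩ := mem_image.1 hX
      obtain ⟨hT'P, hT'i⟩ := mem_filter.1 hT'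
      refine ⟨sdiff_subset.trans sdiff_subset, ?_⟩
      have e : F \ ((F \ T') \ (F \ T)) = T' ∪ (F \ T) := by
        ext x
        have h1 : x ∈ T' → x ∈ F := fun h => hPF T' hT'P h
        simp only [mem_sdiff, mem_union]
        tauto
      rw [e]
      exact union_sdiff_mem_compatJoins hT'P hTP (by rw [hT'i, hTi])
  -- complementation is injective on the differences and lands in the compatible unions
  have hinj : Set.InjOn (fun Z => F \ Z) ↑(𝒮 \\ 𝒯) :=
    sdiff_injOn_of_subset F (𝒮 \\ 𝒯) fun Z hZ => (hmem Z hZ).1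
  have hsub : (𝒮 \\ 𝒯).image (fun Z => F \ Z) ⊆ compatJoins F P c := by
    intro W hW
    obtain ⟨Z, hZ, rfl⟩ := mem_image.1 hW
    exact (hmem Z hZ).2
  calc #P = #𝒮 := hcard𝒮.symm
    _ ≤ #(𝒮 \\ 𝒯) := h37
    _ = #((𝒮 \\ 𝒯).image fun Z => F \ Z) := (card_image_of_injOn hinj).symm
    _ ≤ #(compatJoins F P c) := card_le_card hsub

/-- **Disjoint-dominated configurations.**  If some colour `i` disjoint-dominates (every member of another colour is disjoint
from some member of colour `i`), then the compatible unions are at least as numerous as `P`.  Proof: Ahlswede–Daykin for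
`𝒮 = {F \ S : c S ≠ i} ∪ {T : c T = i}`, `𝒯 = {T : c T = i}`, then complementation. [this work] -/
theorem card_le_card_compatJoins_of_disjoint_dominating (F : Finset α) (P : Finset (Finset α)) (c : Finset α → Fin 3)
    (i : Fin 3) (hPF : ∀ S ∈ P, S ⊆ F) (hP : ∀ S ∈ P, F \ S ∉ P)
    (hdom : ∀ S ∈ P, c S ≠ i → ∃ T ∈ P, c T = i ∧ Disjoint S T) : #P ≤ #(compatJoins F P c) := by
  classical
  set Pi := P.filter fun S => c S = i with hPi
  set Po := P.filter fun S => c S ≠ i with hPo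
  set 𝒪 : Finset (Finset α) := Po.image fun S => F \ S with h𝒪
  set 𝒮 : Finset (Finset α) := 𝒪 ∪ Pi with h𝒮
  -- counting: `#𝒮 = #P`
  have hdisj : Disjoint 𝒪 Pi := by
    rw [disjoint_left]
    intro X hX hX'
    obtain ⟨S, hS, rfl⟩ := mem_image.1 hX
    exact hP S (mem_filter.1 hS).1 (mem_filter.1 hX').1
  have hcard𝒪 : #𝒪 = #Po :=
    card_image_of_injOn (sdiff_injOn_of_subset F Po fun S hS => hPF S (mem_filter.1 hS).1)
  have hcard𝒮 : #𝒮 = #P := by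
    rw [h𝒮, card_union_of_disjoint hdisj, hcard𝒪, hPo, hPi, add_comm]
    exact card_filter_add_card_filter_not _
  -- hypothesis of Theorem 37
  have hhyp : ∀ X ∈ 𝒮, ∃ T ∈ Pi, T ⊆ X := by
    intro X hX
    rcases mem_union.1 hX with hX | hX
    · obtain ⟨S, hS, rfl⟩ := mem_image.1 hX
      obtain ⟨hSP, hSi⟩ := mem_filter.1 hS
      obtain ⟨T, hT, hTi, hST⟩ := hdom S hSP hSi
      refine ⟨T, mem_filter.2 ⟨hT, hTi⟩, ?_⟩
      intro x hx
      exact mem_sdiff.2 ⟨hPF T hT hx, fun hxS => disjoint_left.1 hST hxS hx⟩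
    · exact ⟨X, hX, subset_rfl⟩
  have h37 := Literature.Combinatorics.SetFamily.card_le_card_diffs_of_forall_exists_subset 𝒮 Pi hhyp
  -- every difference is the complement of a compatible union
  have hmem : ∀ Z ∈ 𝒮 \\ Pi, Z ⊆ F ∧ F \ Z ∈ compatJoins F P c := by
    intro Z hZ
    obtain ⟨X, hX, T, hT, rfl⟩ := mem_diffs.1 hZ
    obtain ⟨hTP, hTi⟩ := mem_filter.1 hT
    have hTF := hPF T hTP
    rcases mem_union.1 hX with hX | hX
    · obtain ⟨S, hS, rfl⟩ := mem_image.1 hX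
      obtain ⟨hSP, hSi⟩ := mem_filter.1 hS
      have hSF := hPF S hSP
      refine ⟨sdiff_subset.trans sdiff_subset, ?_⟩
      have e : F \ ((F \ S) \ T) = S ∪ T := by
        ext x
        have h1 : x ∈ S → x ∈ F := fun h => hSF h
        have h2 : x ∈ T → x ∈ F := fun h => hTF h
        simp only [mem_sdiff, mem_union]
        tauto
      rw [e]
      exact union_mem_compatJoins hSP hTP (by rw [hTi]; exact hSi)
    · obtain ⟨hT'P, hT'i⟩ := mem_filter.1 hX
      have hT'F := hPF X hT'P
      refine ⟨sdiff_subset.trans hT'F, ?_⟩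
      have e : F \ (X \ T) = T ∪ (F \ X) := by
        ext x
        have h2 : x ∈ T → x ∈ F := fun h => hTF h
        simp only [mem_sdiff, mem_union]
        tauto
      rw [e]
      exact union_sdiff_mem_compatJoins hTP hT'P (by rw [hT'i, hTi])
  have hinj : Set.InjOn (fun Z => F \ Z) ↑(𝒮 \\ Pi) :=
    sdiff_injOn_of_subset F (𝒮 \\ Pi) fun Z hZ => (hmem Z hZ).1
  have hsub : (𝒮 \\ Pi).image (fun Z => F \ Z) ⊆ compatJoins F P c := by
    intro W hW
    obtain ⟨Z, hZ, rfl⟩ := mem_image.1 hW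
    exact (hmem Z hZ).2
  calc #P = #𝒮 := hcard𝒮.symm
    _ ≤ #(𝒮 \\ Pi) := h37
    _ = #((𝒮 \\ Pi).image fun Z => F \ Z) := (card_image_of_injOn hinj).symm
    _ ≤ #(compatJoins F P c) := card_le_card hsub

/-- **`F ∈ P` suffices.**  If the top of the cube belongs to `P` (with any colour), the colour of `F` cover-dominates, so
`#P ≤ #(compatJoins F P c)`. [this work] -/
theorem card_le_card_compatJoins_of_univ_mem (F : Finset α) (P : Finset (Finset α)) (c : Finset α → Fin 3)
    (hPF : ∀ S ∈ P, S ⊆ F) (hP : ∀ S ∈ P, F \ S ∉ P) (hF : F ∈ P) : #P ≤ #(compatJoins F P c) :=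
  card_le_card_compatJoins_of_cover_dominating F P c (c F) hPF hP
    fun S hS _ => ⟨F, hF, rfl, union_eq_right.2 (hPF S hS)⟩

/-- **`∅ ∈ P` suffices.**  If the bottom of the cube belongs to `P` (with any colour), the colour of `∅` disjoint-dominates, so
`#P ≤ #(compatJoins F P c)`. [this work] -/
theorem card_le_card_compatJoins_of_empty_mem (F : Finset α) (P : Finset (Finset α)) (c : Finset α → Fin 3)
    (hPF : ∀ S ∈ P, S ⊆ F) (hP : ∀ S ∈ P, F \ S ∉ P) (h0 : ∅ ∈ P) : #P ≤ #(compatJoins F P c) :=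
  card_le_card_compatJoins_of_disjoint_dominating F P c (c ∅) hPF hP
    fun S _ _ => ⟨∅, h0, rfl, disjoint_empty_right S⟩

/-! ### Appendix (gen 28, later): the quantitative form — the conjecture holds up to the number of undominated members -/

/-- **Defect form (cover).**  For every colour `i`, the compatible unions number at least `#P` minus the number of members of other colours
WITHOUT a cover-partner of colour `i`.  Proof: the cover-dominated theorem applied to the sub-family of colour-`i` members and cover-dominated
members, plus monotonicity of `compatJoins`. [this work] -/
theorem card_sub_card_uncovered_le_card_compatJoins (F : Finset α) (P : Finset (Finset α)) (c : Finset α → Fin 3)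
    (i : Fin 3) (hPF : ∀ S ∈ P, S ⊆ F) (hP : ∀ S ∈ P, F \ S ∉ P) :
    #P - #(P.filter fun S => c S ≠ i ∧ ∀ T ∈ P, c T = i → S ∪ T ≠ F) ≤ #(compatJoins F P c) := by
  classical
  set Bad := P.filter fun S => c S ≠ i ∧ ∀ T ∈ P, c T = i → S ∪ T ≠ F with hBad
  set P' := P.filter fun S => ¬ (c S ≠ i ∧ ∀ T ∈ P, c T = i → S ∪ T ≠ F) with hP'
  have hsub : P' ⊆ P := filter_subset _ _
  have hcard : #P - #Bad = #P' := by
    have := card_filter_add_card_filter_not (s := P) (fun S => c S ≠ i ∧ ∀ T ∈ P, c T = i → S ∪ T ≠ F)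
    rw [← hBad, ← hP'] at this
    omega
  have hdom : ∀ S ∈ P', c S ≠ i → ∃ T ∈ P', c T = i ∧ S ∪ T = F := by
    intro S hS hSi
    obtain ⟨hSP, hgood⟩ := mem_filter.1 hS
    have : ¬ ∀ T ∈ P, c T = i → S ∪ T ≠ F := fun h => hgood ⟨hSi, h⟩
    push Not at this
    obtain ⟨T, hT, hTi, hST⟩ := this
    exact ⟨T, mem_filter.2 ⟨hT, fun h => h.1 hTi⟩, hTi, hST⟩
  calc #P - #Bad = #P' := hcard
    _ ≤ #(compatJoins F P' c) := card_le_card_compatJoins_of_cover_dominating F P' c i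
        (fun S hS => hPF S (hsub hS)) (fun S hS h => hP S (hsub hS) (hsub h)) hdom
    _ ≤ #(compatJoins F P c) := card_le_card (compatJoins_mono F hsub c)

/-- **Defect form (disjoint).**  For every colour `i`, the compatible unions number at least `#P` minus the number of members of other
colours meeting every member of colour `i`. [this work] -/
theorem card_sub_card_undisjoint_le_card_compatJoins (F : Finset α) (P : Finset (Finset α)) (c : Finset α → Fin 3)
    (i : Fin 3) (hPF : ∀ S ∈ P, S ⊆ F) (hP : ∀ S ∈ P, F \ S ∉ P) :
    #P - #(P.filter fun S => c S ≠ i ∧ ∀ T ∈ P, c T = i → ¬ Disjoint S T) ≤ #(compatJoins F P c) := by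
  classical
  set Bad := P.filter fun S => c S ≠ i ∧ ∀ T ∈ P, c T = i → ¬ Disjoint S T with hBad
  set P' := P.filter fun S => ¬ (c S ≠ i ∧ ∀ T ∈ P, c T = i → ¬ Disjoint S T) with hP'
  have hsub : P' ⊆ P := filter_subset _ _
  have hcard : #P - #Bad = #P' := by
    have := card_filter_add_card_filter_not (s := P) (fun S => c S ≠ i ∧ ∀ T ∈ P, c T = i → ¬ Disjoint S T)
    rw [← hBad, ← hP'] at this
    omega
  have hdom : ∀ S ∈ P', c S ≠ i → ∃ T ∈ P', c T = i ∧ Disjoint S T := by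
    intro S hS hSi
    obtain ⟨hSP, hgood⟩ := mem_filter.1 hS
    have : ¬ ∀ T ∈ P, c T = i → ¬ Disjoint S T := fun h => hgood ⟨hSi, h⟩
    push Not at this
    obtain ⟨T, hT, hTi, hST⟩ := this
    exact ⟨T, mem_filter.2 ⟨hT, fun h => h.1 hTi⟩, hTi, hST⟩
  calc #P - #Bad = #P' := hcard
    _ ≤ #(compatJoins F P' c) := card_le_card_compatJoins_of_disjoint_dominating F P' c i
        (fun S hS => hPF S (hsub hS)) (fun S hS h => hP S (hsub hS) (hsub h)) hdom
    _ ≤ #(compatJoins F P c) := card_le_card (compatJoins_mono F hsub c)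

end Summit.CriticalPhenomena.PercolationContinuityZ3.Theorems.SahiColouredDaykin
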